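import Summits.HubbardSuperconductivity.HubbardSuperconductivity.Theorems.InfiniteVolumeFirstCoarseTightnessCorollaries
import Summits.HubbardSuperconductivity.HubbardSuperconductivity.Theorems.NoNormalLimitState.Negative.NoUniformAtomFloor

/-!
# `NoNormalLimitState`: the atom floor must be chosen AFTER the coupling — from the mesoscopic ceiling

Negative-side support for the crux `NoNormalLimitState` (stmt-HubbardSuperconductivity-18533, route
`InfiniteVolumeFirst`). The sibling file `Negative/NoUniformAtomFloor.lean` refutes the U-UNIFORM
atom-floor strengthening of the crux MODULO the rank-3 crux `NoInfraredPileUp` (tightness). Here the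
same strengthening is refuted modulo the MESOSCOPIC PAIR-ORDER CEILING (MC) of the coarse-tightness
programme instead (`InfiniteVolumeFirstCoarseTightnessCorollaries`; (MC) is discharged by the block
kinetic budget, `InfiniteVolumeFirstCoarseTightnessPreAssembly` + the deviation budget), with NO tightness
input: by `atom_le_of_mesoCeiling` every torus-limit atom of every admissible family at coupling
`U ≤ 1` is `≤ (c₂ + c₃) U^{1/4}`, so for a floor `a > 0` any coupling `U` with
`(c₂ + c₃) U^{1/4} < a` and any admissible family (they exist, `NoGo.exists_groundStateInSector_seq`)
with any convergent subsequence (`exists_convergent_subseq`) violates the floor.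

* `noNormalLimitState_uniformFloor_false_of_mesoCeiling` — (MC) `→ ¬ (∃ δ ∃ a > 0 ∀ U₀ ∃ U ∈ (0,U₀),`
  `every admissible family's limit atoms ≥ a)`; registered stub `stub_uniformFloorFalseOfMesoCeiling`.

So in any proof of the crux the atom is `a(U) → 0⁺` at rate at most `U^{1/4}` — now for a reason
independent of the route's own rank-3 crux. Sources: T. Kennedy, E. H. Lieb, B. S. Shastry, PRL 61
(1988) 2582; J. Fröhlich, B. Simon, T. Spencer, CMP 50 (1976) 79, §3. Elementary composition of landed
lemmas; no definition and no named fact is introduced ((MC) is a hypothesis).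
-/

noncomputable section

-- the mandated namespace `Summit.<Summit>.<Problem>.Theorems` repeats `HubbardSuperconductivity`
-- (single-problem summit, D-0017), which the `dupNamespace` linter flags on every declaration
set_option linter.dupNamespace false

namespace Summit.HubbardSuperconductivity.HubbardSuperconductivity.Theorems.NoNormalLimitState.Negative

open Literature.MathematicalPhysics.QuantumLattice Literature.Probability.LatticeModels Matrix Finset
  Filter
open Summit.HubbardSuperconductivity.HubbardSuperconductivity.Theorems.CoarseTightness
open scoped ComplexConjugate ComplexOrder Topology

/-- **The atom floor must be chosen AFTER the coupling (modulo the mesoscopic pair-order ceiling).**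
If the ground states of the repulsive Hubbard torus obey the ceiling (MC)
`𝓜_R(ψ) ≤ c₁/R + c₂√τ + (c₃/√τ)√(U + c₄/R)` (`c₂, c₃ ≥ 0`), then there is NO doping `δ` and floor
`a > 0` such that at arbitrarily weak coupling every admissible family's torus-limit atoms are `≥ a`:
pick `U < U₀` with `(c₂ + c₃) U^{1/4} < a`, an admissible family and a convergent subsequence; its atom
is `≤ (c₂ + c₃) U^{1/4}` by `atom_le_of_mesoCeiling`. Kennedy–Lieb–Shastry, PRL 61 (1988) 2582. [folklore] -/
theorem noNormalLimitState_uniformFloor_false_of_mesoCeiling {c₁ c₂ c₃ c₄ : ℝ} (h₂ : 0 ≤ c₂)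
    (h₃ : 0 ≤ c₃)
    (hM : ∀ τ ∈ Set.Ioc (0:ℝ) 1, ∀ R : ℕ, 1 ≤ R → ∀ (L : ℕ) [NeZero L], 2 * R + 2 ≤ L →
      ∀ U ∈ Set.Icc (0:ℝ) 1, ∀ (n : ℕ) (φ : Fock (Orb (FermionTorus 2 L))), star φ ⬝ᵥ φ = 1 →
        IsGroundStateInSector (hubbardTorus 2 L 1 U) (2 * n) 0 φ →
          (∑ a : TorusSite 2 L, (star ((∑ u : Fin 2 → Fin R,
              localPair dWaveFormFactor L (a + fun i => ((u i : ℕ) : ZMod L))) *ᵥ φ) ⬝ᵥ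
            ((∑ u : Fin 2 → Fin R,
              localPair dWaveFormFactor L (a + fun i => ((u i : ℕ) : ZMod L))) *ᵥ φ)).re) /
            ((L : ℝ) ^ 2 * (R : ℝ) ^ 4) ≤
          c₁ / R + c₂ * Real.sqrt τ + c₃ / Real.sqrt τ * Real.sqrt (U + c₄ / R)) :
    ¬ (∃ δ ∈ Set.Ioo (0:ℝ) (1 / 2), ∃ a : ℝ, 0 < a ∧ ∀ U₀ : ℝ, 0 < U₀ → ∃ U ∈ Set.Ioo (0:ℝ) U₀,
      ∀ (N : ℕ → ℕ) (ψ : ∀ L, Fock (Orb (FermionTorus 2 L))),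
      (∀ L, Even L → N L = 2 * ⌊(1 - δ) * (L : ℝ) ^ 2 / 2⌋₊ ∧ star (ψ L) ⬝ᵥ ψ L = 1 ∧
        IsGroundStateInSector (hubbardTorus 2 L 1 U) (N L) 0 (ψ L)) →
      ∀ (Ls : ℕ → ℕ) (C : Site 2 → ℝ), StrictMono Ls → (∀ j, Even (Ls j)) →
        (∀ x : Site 2, Tendsto (fun j : ℕ => (∑ y ∈ halfOpenBox 2 (Ls j),
          torusPullback (pairFieldCorr dWaveFormFactor ψ) (Ls j) (x + y) y) / ((Ls j : ℕ) : ℝ) ^ 2)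
          atTop (𝓝 (C x))) →
        a ≤ liminf (fun R : ℕ => (∑ x ∈ halfOpenBox 2 R, ∑ y ∈ halfOpenBox 2 R, C (x - y)) /
          ((R : ℕ) : ℝ) ^ 4) atTop) := by
  rintro ⟨δ, hδ, a, ha, h⟩
  -- a coupling with `(c₂ + c₃) U^{1/4} < a`
  set s : ℝ := a / (2 * (c₂ + c₃ + 1)) with hs
  have hs0 : 0 < s := by positivity
  obtain ⟨U, hU, hfloor⟩ := h (min 1 (s ^ 4)) (lt_min one_pos (by positivity))
  have hU0 : 0 < U := hU.1
  have hU1 : U ≤ 1 := hU.2.le.trans (min_le_left _ _)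
  have hUs : U ≤ s ^ 4 := hU.2.le.trans (min_le_right _ _)
  have hroot : Real.sqrt (Real.sqrt U) ≤ s := by
    have h1 : Real.sqrt U ≤ s ^ 2 := by
      rw [Real.sqrt_le_left (by positivity)]
      calc U ≤ s ^ 4 := hUs
        _ = (s ^ 2) ^ 2 := by ring
    rw [Real.sqrt_le_left hs0.le]
    exact h1
  have hsmall : (c₂ + c₃) * Real.sqrt (Real.sqrt U) < a := by
    calc (c₂ + c₃) * Real.sqrt (Real.sqrt U) ≤ (c₂ + c₃) * s :=
          mul_le_mul_of_nonneg_left hroot (by positivity)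
      _ < (c₂ + c₃ + 1) * s := by nlinarith
      _ = a / 2 := by rw [hs]; field_simp
      _ < a := by linarith
  -- an admissible family and a convergent subsequence
  have hδ1 : (-1 : ℝ) ≤ δ := by linarith [hδ.1]
  obtain ⟨N, ψ, hadm0⟩ :=
    Summit.HubbardSuperconductivity.NoGo.exists_groundStateInSector_seq 1 U δ hδ1
  have hadm : ∀ L, Even L → N L = 2 * ⌊(1 - δ) * (L : ℝ) ^ 2 / 2⌋₊ ∧ star (ψ L) ⬝ᵥ ψ L = 1 ∧
      IsGroundStateInSector (hubbardTorus 2 L 1 U) (N L) 0 (ψ L) := fun L _ => hadm0 L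
  obtain ⟨Ls, C, hLs, heven, hconv⟩ := exists_convergent_subseq ψ fun L hL => (hadm L hL).2.1
  have hge := hfloor N ψ hadm Ls C hLs heven hconv
  have hle := atom_le_of_mesoCeiling hM δ U ⟨hU0, hU1⟩ N ψ hadm Ls C hLs heven hconv
  linarith

/-- **Registered stub** (`stub_uniformFloorFalseOfMesoCeiling`, crux stmt-HubbardSuperconductivity-18533):
the U-uniform atom-floor strengthening of `NoNormalLimitState` is false modulo the mesoscopic
pair-order ceiling (MC). Kennedy–Lieb–Shastry, PRL 61 (1988) 2582. [folklore] -/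
theorem stub_uniformFloorFalseOfMesoCeiling :
    ∀ (c₁ c₂ c₃ c₄ : ℝ), 0 ≤ c₂ → 0 ≤ c₃ →
      (∀ τ ∈ Set.Ioc (0:ℝ) 1, ∀ R : ℕ, 1 ≤ R → ∀ (L : ℕ) [NeZero L], 2 * R + 2 ≤ L →
        ∀ U ∈ Set.Icc (0:ℝ) 1, ∀ (n : ℕ) (φ : Fock (Orb (FermionTorus 2 L))), star φ ⬝ᵥ φ = 1 →
          IsGroundStateInSector (hubbardTorus 2 L 1 U) (2 * n) 0 φ →
            (∑ a : TorusSite 2 L, (star ((∑ u : Fin 2 → Fin R,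
                localPair dWaveFormFactor L (a + fun i => ((u i : ℕ) : ZMod L))) *ᵥ φ) ⬝ᵥ
              ((∑ u : Fin 2 → Fin R,
                localPair dWaveFormFactor L (a + fun i => ((u i : ℕ) : ZMod L))) *ᵥ φ)).re) /
              ((L : ℝ) ^ 2 * (R : ℝ) ^ 4) ≤
            c₁ / R + c₂ * Real.sqrt τ + c₃ / Real.sqrt τ * Real.sqrt (U + c₄ / R)) →
      ¬ (∃ δ ∈ Set.Ioo (0:ℝ) (1 / 2), ∃ a : ℝ, 0 < a ∧ ∀ U₀ : ℝ, 0 < U₀ → ∃ U ∈ Set.Ioo (0:ℝ) U₀,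
        ∀ (N : ℕ → ℕ) (ψ : ∀ L, Fock (Orb (FermionTorus 2 L))),
        (∀ L, Even L → N L = 2 * ⌊(1 - δ) * (L : ℝ) ^ 2 / 2⌋₊ ∧ star (ψ L) ⬝ᵥ ψ L = 1 ∧
          IsGroundStateInSector (hubbardTorus 2 L 1 U) (N L) 0 (ψ L)) →
        ∀ (Ls : ℕ → ℕ) (C : Site 2 → ℝ), StrictMono Ls → (∀ j, Even (Ls j)) →
          (∀ x : Site 2, Tendsto (fun j : ℕ => (∑ y ∈ halfOpenBox 2 (Ls j),
            torusPullback (pairFieldCorr dWaveFormFactor ψ) (Ls j) (x + y) y) / ((Ls j : ℕ) : ℝ) ^ 2)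
            atTop (𝓝 (C x))) →
          a ≤ liminf (fun R : ℕ => (∑ x ∈ halfOpenBox 2 R, ∑ y ∈ halfOpenBox 2 R, C (x - y)) /
            ((R : ℕ) : ℝ) ^ 4) atTop) :=
  fun _ _ _ _ h₂ h₃ hM => noNormalLimitState_uniformFloor_false_of_mesoCeiling h₂ h₃ hM

end Summit.HubbardSuperconductivity.HubbardSuperconductivity.Theorems.NoNormalLimitState.Negative

end
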